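import Mathlib
import Literature.Computability.Complexity.PNPWave0
import HarnessLib

/-!
# PneNP — problem statement (D-0007: predetermined problem; this file is CREATED BY THE OPERATOR via docs/m5/create_problems.py, never proposed by agents)

Prop-valued definition of the summit statement P ≠ NP in Cook's Clay formulation, over the
classes `Literature.Computability.Complexity.PNPWave0.P`, `Literature.Computability.Complexity.PNPWave0.NP` of `Literature.Computability.Complexity.PNPWave0`
(machine model: Mathlib `Turing.FinTM2` / `Turing.TM2ComputableInPolyTime`).

Source: S. Cook, *The P versus NP problem*, Clay Mathematics Institute official problem
description (2000; printed in *The Millennium Prize Problems*, CMI/AMS 2006, 87–104), §1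
"Statement of the Problem": `P = {L | L = L(M) for some Turing machine M which runs in
polynomial time}`; `L ∈ NP` iff there are `k ∈ ℕ` and a polynomial-time checking relation `R`
with `w ∈ L ⟺ ∃ y (|y| ≤ |w|^k ∧ R(w, y))`; "Problem Statement: Does P = NP?". Cook, §1: the
answer is independent of the alphabet `Σ` as long as `|Σ| ≥ 2`; we fix `Σ = {0, 1} = Bool`.
-/

-- provenance: harness21/H21/H21/Statements/PNP/Wave0.lean @ 7bcf3cf (interim HEAD d8f2665); M5 mechanical rewrite
namespace Literature.PNP

open _root_.Computability

/-- **pnp.S01** (P ≠ NP; Cook, Clay problem description §1 "Statement of the Problem";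
Cook 1971). The conjecture that some language over `{0, 1}` with a polynomial-time checking
relation and certificate bound `|y| ≤ |w| ^ k` (i.e. in `NP Bool`, pnp.S08) is decided by no
deterministic polynomial-time Turing machine (i.e. is not in `P Bool`, pnp.S07). Stated in the
form `∃ L ∈ NP, L ∉ P`, which is Cook's `P ≠ NP` given the (trivial, Cook §1) inclusion
`P ⊆ NP`. Open. [cite: CookClay2006, §1] [cite: Cook1971] [problem: pnp] -/
def PNeNP : Prop :=
  ∃ L : Language Bool, L ∈ Literature.Computability.Complexity.PNPWave0.NP Bool ∧ L ∉ Literature.Computability.Complexity.PNPWave0.P Bool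

end Literature.PNP

/-- The `PneNP` problem statement (D-0010; canonical root-level name checked by the gate) := `Literature.PNP.PNeNP`. [problem: pnp] -/
def PneNP : Prop := Literature.PNP.PNeNP
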